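import Summits.NavierStokesRegularity.NavierStokesRegularity.Theorems.ScenarioCensusAgeingMeterLaw
import Summits.NavierStokesRegularity.NavierStokesRegularity.Theorems.ScenarioCensusSilenceMeterRows
import HarnessLib

/-!
# AGEING METER port, part 3/5: §F the census rows `Row_A2agT` / `V` / `0` / `U` (DECIDED) and `Row_A2agF` (OPEN), row proofs, nestings; §G controls (the rows are dynamical, not kinematic;
# SILENCE METER's `e₀` BY NAME)

Re-homed for the scenario census (typer seat ns-census-typer-1 g10; the cells A2agT / A2agV / A2ag0 / A2agU / A2agFf / A2ag2v are MEMBERS OF RECORD «DECIDED IN KERNEL IN FILES» of row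
A2 (item 77: REV 1 critic PASS tier B, REV 3 idea-crit-3 g10 ROW WORDS BY KEY 11:55:14Z; ref PRE-CHECK ✓ §18.27 / §18.37; lead label), A2agF OPEN ≡ D7; this port makes the decided
cells TREE-decided): VERBATIM PORT of ns-idea-2 LINE g17-2 «ageing-meter» REV 3, `pub/ideators/ns-idea-2/lines/ageing-meter/line-ageing-meter.rev3.lean` sha16 a9c9c668d639c4c6
(1173 l., lean check rc 0, 0 sorry), split for the 400-line rule into `ScenarioCensusAgeingMeter` (§A–§C) → `…AgeingMeterLaw` (§D–§E) → `…AgeingMeterRows` (§F–§G) →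
`…AgeingMeterVertex` (§F′) → `…AgeingMeterTwoVertex` (§F″, §H + census KEYS).  Lean text VERBATIM in namespace `…Theorems.ScenarioCensus.AgeingMeter` (the line's
`…Lines.AgeingMeter` re-homed); port edits: the line's `local notation "E3"` is spelled as the reducible `abbrev E3` of every census file; declarations the line restates VERBATIM
from the landed SILENCE METER (`simBall`, `simBall_neg_one`, `smul_mem_simBall`, `e₀`, `norm_e₀`) and HULL METER (`pastPart`, `pastPart_of_neg`, `pastPart_of_not_neg`,
`isTypeIAncientMild_pastPart`, `isDiscretelySelfSimilar_pastPart`, `PastInvariant`, `PastLiouville`) ports are taken BY NAME (gate lint dedup.landed); `set_option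
linter.unusedVariables false` dropped (binders the linter names are `_`-prefixed); `@[conjecture]` on the OPEN row `Row_A2agF` (≡ census D7); one-line docstrings added where missing
(gate lint).  Statements untouched.

No census VALUE is moved here (row A2 stays OPEN-WITH-LINE; the members become TREE-decided by name); D7 / (L′) are NOT proved; no summit statement is proved by this file. Lemmas that restate already-landed tree declarations are taken BY NAME (gate lint `dedup.landed`): `simBall` = `SilenceMeter.simBall`, `smul_mem_simBall` = `SilenceMeter.smul_mem_simBall`, `e₀` = `SilenceMeter.e₀`, `pastPart` = `HullMeter.pastPart`, `isTypeIAncientMild_pastPart` = `HullMeter.isTypeIAncientMild_pastPart`, `isDiscretelySelfSimilar_pastPart` = `HullMeter.isDiscretelySelfSimilar_pastPart`, `PastInvariant` = `HullMeter.PastInvariant`, `PastLiouville` = `HullMeter.PastLiouville`.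
-/

-- the summit and its single problem share the name `NavierStokesRegularity` (D-0017 nested layout)
set_option linter.dupNamespace false

noncomputable section

open Set Function Filter Metric
open scoped Topology
open Literature.Analysis Literature.Analysis.FluidPDE
open Summit.NavierStokesRegularity.NavierStokesRegularity.Theorems
open Summit.NavierStokesRegularity.NavierStokesRegularity.Theorems.ScenarioCensus.ScrewBlowdown
open Summit.NavierStokesRegularity.NavierStokesRegularity.Theorems.NearExtremalTransiencePerFlow.FilamentSelection
open Summit.NavierStokesRegularity.NavierStokesRegularity.Cruxes.ScarEnvelopeTypeI.AxisActivity

namespace Summit.NavierStokesRegularity.NavierStokesRegularity.Theorems.ScenarioCensus.AgeingMeter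

variable {C : ℝ} {u : ℝ → E3 → E3}

/-! ## F. Census rows (shape `∀ C u, IsTypeIAncientMild C u → <cell> → u ≡ 0` on `t < 0`) -/

/-- **Row A2ag-T** (EXACT co-motion recurrence of a germ, EXCLUDED — PROVED): some germ of some slice recurs after a
lag `δ > 0` modulo a rigid co-motion `x ↦ L x + b` ⇒ `u ≡ 0`.  Discrete travelling / rotating / screw waves and
discrete breathers of the class are all trivial. -/
def Row_A2agT : Prop :=
  ∀ (C : ℝ) (u : ℝ → E3 → E3), IsTypeIAncientMild C u →
    (∃ (L : E3 ≃ₗᵢ[ℝ] E3) (b : E3) (δ : ℝ), 0 < δ ∧ ∃ t₀ < (0 : ℝ), ∃ U : Set E3, IsOpen U ∧ U.Nonempty ∧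
      ∀ x ∈ U, L.symm (u (t₀ - δ) (L x + b)) = u t₀ x) →
    ∀ t < (0 : ℝ), ∀ x, u t x = 0

/-- **Row A2ag-V** (EXACT interior-vertex scaling recurrence of a germ, EXCLUDED — PROVED): some germ of some slice
recurs under a parabolic scaling with factor `0 < λ < 1` composed with a lag `δ > 0` (vertex `λ²δ/(λ²−1) < 0`)
⇒ `u ≡ 0`. -/
def Row_A2agV : Prop :=
  ∀ (C : ℝ) (u : ℝ → E3 → E3), IsTypeIAncientMild C u →
    (∃ l δ : ℝ, 0 < l ∧ l < 1 ∧ 0 < δ ∧ ∃ t₀ < (0 : ℝ), ∃ U : Set E3, IsOpen U ∧ U.Nonempty ∧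
      ∀ x ∈ U, l • u (l ^ 2 * (t₀ - δ)) (l • x) = u t₀ x) →
    ∀ t < (0 : ℝ), ∀ x, u t x = 0

/-- **Row A2ag-0** (ASYMPTOTIC recurrence on one receding similarity ball, EXCLUDED — PROVED): for some lag
`δ > 0`, some co-motion, some ball `B̄(η₀, ρ)` (`ρ > 0`) and some far-past times `s_k → −∞` the ageing readings on
`√(−s_k)·B̄(η₀, ρ)` tend to `0` ⇒ `u ≡ 0`. -/
def Row_A2ag0 : Prop :=
  ∀ (C : ℝ) (u : ℝ → E3 → E3), IsTypeIAncientMild C u →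
    (∃ (L : E3 ≃ₗᵢ[ℝ] E3) (b : E3) (δ : ℝ), 0 < δ ∧ ∃ (η₀ : E3) (ρ : ℝ), 0 < ρ ∧ ∃ s : ℕ → ℝ,
      RecursAlong u L b δ η₀ ρ s) →
    ∀ t < (0 : ℝ), ∀ x, u t x = 0

/-- **Row A2ag-U** (UNIFORM: `f`-recurrent along a sequence with the UNIVERSAL `f(C, L, b, δ, η₀, ρ)`, EXCLUDED —
PROVED). -/
def Row_A2agU : Prop :=
  ∀ (C : ℝ) (L : E3 ≃ₗᵢ[ℝ] E3) (b : E3) (δ : ℝ), 0 < δ → ∀ (η₀ : E3) (ρ : ℝ), 0 < ρ →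
    ∃ f > (0 : ℝ), ∀ u : ℝ → E3 → E3, IsTypeIAncientMild C u →
      (∃ s : ℕ → ℝ, (∀ k, s k < 0) ∧ Tendsto s atTop atBot ∧
        ∀ k, ∀ z ∈ SilenceMeter.simBall η₀ ρ (s k), reading L b δ u (s k) z ≤ f) →
      ∀ t < (0 : ℝ), ∀ x, u t x = 0

/-- **Row A2ag-F** (FUTURE-vertex scaling recurrence of a germ: factor `λ > 1` composed with a lag `δ > 0`, vertex
`λ²δ/(λ²−1) > 0`) — OPEN, typed only.  It contains the time-advanced restrictions `t ↦ U(t − t_T)` of every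
apex-DSS element `U` with a coarse factor (census D7), so deciding it decides D7-type cells; nothing is claimed. -/
@[conjecture] def Row_A2agF : Prop :=
  ∀ (C : ℝ) (u : ℝ → E3 → E3), IsTypeIAncientMild C u →
    (∃ l δ : ℝ, 1 < l ∧ 0 < δ ∧ ∃ t₀ < (0 : ℝ), ∃ U : Set E3, IsOpen U ∧ U.Nonempty ∧
      ∀ x ∈ U, l • u (l ^ 2 * (t₀ - δ)) (l • x) = u t₀ x) →
    ∀ t < (0 : ℝ), ∀ x, u t x = 0

/-! ### Row proofs -/

/-- **Row A2agT holds.** -/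
theorem row_A2agT : Row_A2agT := by
  rintro C u hu ⟨L, b, δ, hδ, t₀, ht₀, U, hU, hne, heq⟩
  exact eq_zero_of_comotionRecurrent hu L b hδ ht₀ hU hne heq

/-- **Row A2agV holds.** -/
theorem row_A2agV : Row_A2agV := by
  rintro C u hu ⟨l, δ, hl, hl1, hδ, t₀, ht₀, U, hU, hne, heq⟩
  exact eq_zero_of_interiorVertexRecurrent hu hl hl1 hδ ht₀ hU hne heq

/-- **Row A2ag0 holds.** -/
theorem row_A2ag0 : Row_A2ag0 := by
  rintro C u hu ⟨L, b, δ, hδ, η₀, ρ, hρ, s, hs⟩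
  exact eq_zero_of_recursAlong hu hδ hρ hs

/-- **Row A2agU holds.** -/
theorem row_A2agU : Row_A2agU := by
  intro C L b δ hδ η₀ ρ hρ
  obtain ⟨f, hf, hfl⟩ := universal_ageing C L b hδ η₀ hρ
  refine ⟨f, hf, fun u hu ⟨s, hs0, hslim, hq⟩ => ?_⟩
  by_contra hne
  push Not at hne
  obtain ⟨t, ht, x, hx⟩ := hne
  obtain ⟨k, z, hz, hlt⟩ := hfl u hu ⟨t, ht, x, hx⟩ s hs0 hslim
  exact absurd (hq k z hz) (not_le.2 hlt)

/-! ### Nestings (the decided rows are genuinely nested; the residual is none of them renamed) -/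

/-- The uniform row implies the asymptotic row (a recurring sequence is eventually `f`-recurrent). -/
theorem row_A2ag0_of_row_A2agU (h : Row_A2agU) : Row_A2ag0 := by
  rintro C u hu ⟨L, b, δ, hδ, η₀, ρ, hρ, s, hs0, hslim, ε, hε, hq⟩
  obtain ⟨f, hf, hfl⟩ := h C L b δ hδ η₀ ρ hρ
  have hev : ∀ᶠ k in atTop, ε k ≤ f := (hε.eventually (Iic_mem_nhds hf)).mono fun k hk => hk
  obtain ⟨N, hN⟩ := hev.exists_forall_of_atTop
  refine hfl u hu ⟨fun k => s (k + N), fun k => hs0 _, hslim.comp (tendsto_add_atTop_nat N), fun k z hz => ?_⟩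
  exact (hq (k + N) z hz).trans (hN _ (Nat.le_add_left N k))

/-! ## G. Controls: the rows are dynamical, not kinematic -/

-- `e₀`: the line restates the tree's `SilenceMeter.e₀`; taken BY NAME (gate lint dedup.landed).

/-- The unit vector `e₂`. -/
def e₂ : E3 := EuclideanSpace.single 2 1

/-- `‖e₂‖ = 1`. -/
theorem norm_e₂ : ‖e₂‖ = 1 := by simp [e₂]

/-- A smooth nonzero TRAVELLING WAVE `w(t, x) = cos(⟨x, SilenceMeter.e₀⟩ + t) e₂`: it recurs EXACTLY after every lag `δ` modulo
the translation `x ↦ x + δ SilenceMeter.e₀` (co-motion with `L = 1`, `b = δ SilenceMeter.e₀`).  So the hypothesis of `Row_A2agT` is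
kinematically satisfiable by nonzero smooth divergence-free fields: what kills is membership in the class (decay
`C/√(−t)` along the drift). -/
def travellingWave : ℝ → E3 → E3 := fun t x => Real.cos (inner ℝ x SilenceMeter.e₀ + t) • e₂

/-- The travelling wave recurs modulo a translation. -/
theorem travellingWave_recurs (δ t : ℝ) (x : E3) :
    travellingWave (t - δ) (x + δ • SilenceMeter.e₀) = travellingWave t x := by
  simp only [travellingWave, inner_add_left, real_inner_smul_left, real_inner_self_eq_norm_sq, SilenceMeter.norm_e₀, one_pow,
    mul_one]
  congr 2
  ring

/-- The travelling wave is not the zero field. -/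
theorem travellingWave_ne_zero : travellingWave 0 0 ≠ 0 := by
  simp [travellingWave, e₂]

/-- A nonzero field EXPLODING AT THE INTERIOR VERTEX, `w(t, x) = (√(t_T − t))⁻¹ e₂` (junk value `0` after `t_T`),
satisfies the interior-vertex recurrence of `Row_A2agV` for the factor `λ` and lag `δ` with `t_T = λ²δ/(λ²−1)`,
at every `(t, x)`.  So what kills in `Row_A2agV` is continuity of class elements at interior points of the past. -/
def vertexBurst (l δ : ℝ) : ℝ → E3 → E3 := fun t _ => (Real.sqrt (vertex l δ - t))⁻¹ • e₂

/-- The vertex burst recurs about its vertex. -/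
theorem vertexBurst_recurs {l δ : ℝ} (hl : 0 < l) (hl1 : l ≠ 1) (t : ℝ) (x : E3) :
    l • vertexBurst l δ (l ^ 2 * (t - δ)) (l • x) = vertexBurst l δ t x := by
  have hl2 : l ^ 2 ≠ 1 := by
    intro h
    have h' : (l - 1) * (l + 1) = 0 := by nlinarith
    rcases mul_eq_zero.1 h' with h1 | h1
    · exact hl1 (by linarith)
    · linarith
  simp only [vertexBurst]
  rw [vertex_step hl2 t, show vertex l δ - (vertex l δ + l ^ 2 * (t - vertex l δ)) = l ^ 2 * (vertex l δ - t)
    by ring, Real.sqrt_mul (sq_nonneg l), Real.sqrt_sq hl.le, smul_smul]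
  congr 1
  rcases eq_or_ne (Real.sqrt (vertex l δ - t)) 0 with h | h
  · simp [h]
  · field_simp

/-- The vertex burst is not the zero field. -/
theorem vertexBurst_ne_zero {l δ : ℝ} : vertexBurst l δ (vertex l δ - 1) 0 ≠ 0 := by
  simp [vertexBurst, e₂]

/-- The zero field recurs (every reading vanishes): `RecursAlong` is satisfiable, so the rows are not vacuous. -/
theorem control_zero_recurs (L : E3 ≃ₗᵢ[ℝ] E3) (b : E3) (δ : ℝ) (η₀ : E3) (ρ : ℝ) {s : ℕ → ℝ}
    (hs0 : ∀ k, s k < 0) (hslim : Tendsto s atTop atBot) :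
    RecursAlong (fun _ _ => (0 : E3)) L b δ η₀ ρ s :=
  ⟨hs0, hslim, fun _ => 0, tendsto_const_nhds, fun k z hz => by simp [reading]⟩

/-- No nonzero floor for the zero field. -/
theorem control_zero_noFloor (L : E3 ≃ₗᵢ[ℝ] E3) (b : E3) (δ : ℝ) (η₀ : E3) (ρ : ℝ) {f : ℝ} (hf : 0 ≤ f) :
    ¬ HasAgeingFloor (fun _ _ => (0 : E3)) L b δ η₀ ρ f := by
  rintro ⟨T, hT, h⟩
  obtain ⟨z, -, hz⟩ := h (T - 1) (by linarith)
  simp [reading] at hz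
  exact absurd hz (not_lt.2 hf)

/-- A field with an ageing floor `f ≥ 0` is not identically zero. -/
theorem ne_zero_of_hasAgeingFloor {L : E3 ≃ₗᵢ[ℝ] E3} {b : E3} {δ : ℝ} {η₀ : E3} {ρ f : ℝ} (hf : 0 ≤ f)
    (h : HasAgeingFloor u L b δ η₀ ρ f) : ∃ t, ∃ x, u t x ≠ 0 := by
  by_contra H
  push Not at H
  have hu0 : u = fun _ _ => (0 : E3) := by
    funext t x; exact H t x
  exact control_zero_noFloor L b δ η₀ ρ hf (hu0 ▸ h)

end Summit.NavierStokesRegularity.NavierStokesRegularity.Theorems.ScenarioCensus.AgeingMeter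

end
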